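import Mathlib
import HarnessLib
import Summits.NavierStokesRegularity.NavierStokesRegularity.Theorems.TaylorModelRungThreeCertificateReadoutVSoundA
import Summits.NavierStokesRegularity.NavierStokesRegularity.Theorems.TaylorModelRungThreeCertificateReadoutsSound

/-!
# Crux K1b-DR (stmt-NavierStokesRegularity-23954), line `taylor-model` — v3 read-outs SOUNDNESS, part B: the clauses (R6),
# (R9), (R10), (R11) of `ReadoutsV` for the interpreted records, and the assembly **`readoutsV_of_checks`** (typer g32; clause
# text = ns-tm-g4 g3's `…VReadoutsDefs`; kernel soundness = `…ReadoutVStepSound`; bridges = engine-1 g67's `…FormatVInterpLemmas`)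

* `readout_R6` (in-step boxes), `readout_R10` (derivative kernel), `readout_R9` (base landing), `readout_R11` (landing derivative,
  with the ENTRY box `|ζ_c| ≤ rB_c` of the polytope parametrisation as a hypothesis — engine-1's entry clause), the partner-face
  constraint `partner_face` from `InPoly`;
* `readoutsV_of_checks : KitOK → checkReadouts = true → (R0)…(R3) (the composer's clauses, as hypotheses) → (entry box) →
  ReadoutsV (toCertDataVW …) (toBoxesW …) (toRadiiW …) (toReadoutData … G ΛT)`.

HONEST FRAMING: kernel bookkeeping for the MODEL certificate №23954 (rung TL-M3); nothing here is a statement about the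
Navier–Stokes equations.
-/

-- the sub-problem namespace repeats the summit name by design (D-0017)
set_option linter.dupNamespace false

namespace Summit.NavierStokesRegularity.NavierStokesRegularity.Theorems.TaylorModelCert

open scoped BigOperators
open Set
open Literature.Analysis.FluidPDE.TaoCascade Literature.Analysis.FluidPDE.TaoCascade.TaylorChain
open Summit.NavierStokesRegularity.NavierStokesRegularity.Theorems.TaylorModelReadout
open Summit.NavierStokesRegularity.NavierStokesRegularity.Theorems.TaylorModelV

namespace CertTablesV

variable {TV : CertTablesV} {kitOf : ℕ → CoreKit} {wT : ℕ → Array Dyad} {sc : ScalarsV} {A : ReadoutAux QS2}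

/-! ### (R6) in-step boxes -/

/-- The generic (R6) statement over a hull level `l : Fin 3` and its in-step box. [folklore] -/
theorem readout_R6_gen (hk : KitOK TV kitOf) {j : ℕ} {l : Fin 3} {Hl Yl : Array IntervalD}
    (hH : Hl = TV.hullBox kitOf wT j l ((TV.base.stage j).S - 1))
    (hY : Yl = TV.base.inStepY TV.prec TV.base.pdeg ((TV.roIn kitOf wT A j).TP TV.base) (TV.coreVW kitOf wT j ((TV.base.stage j).S - 1)).J
      (TV.hD j ((TV.base.stage j).S - 1)) ((TV.roIn kitOf wT A j).Min TV.base) Hl (TV.xD j ((TV.base.stage j).S - 1)))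
    {u : ℝ} (hu : u ∈ Icc 0 ((TV.toCertDataVW kitOf wT sc).h j ((TV.toCertDataVW kitOf wT sc).S j - 1)))
    {Ak : Ker} (hA : InStepKer (TV.toCertDataVW kitOf wT sc) (TV.toBoxesW kitOf wT) j ((TV.toCertDataVW kitOf wT sc).S j - 1) u Ak)
    {y : Fin 4 → ℤ → ℝ} (hy : InBox (TV.toCertDataVW kitOf wT sc) ((TV.toBoxesW kitOf wT).hlo l j ((TV.toCertDataVW kitOf wT sc).S j - 1))
      ((TV.toBoxesW kitOf wT).hhi l j ((TV.toCertDataVW kitOf wT sc).S j - 1)) y)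
    {r : Fin 4 → ℤ → ℝ} (hr : AbsLeW (TV.toCertDataVW kitOf wT sc) r
      (fun i k => (TV.toBoxesW kitOf wT).J j ((TV.toCertDataVW kitOf wT sc).S j - 1) i k * u ^ ((TV.toCertDataVW kitOf wT sc).pdeg + 1))) :
    InBox (TV.toCertDataVW kitOf wT sc) (TV.base.vecF (IntervalD.loR Yl)) (TV.base.vecF (IntervalD.hiR Yl))
      ((TV.toCertDataVW kitOf wT sc).TP j ((TV.toCertDataVW kitOf wT sc).S j - 1) u + r +
        kapp (TV.toCertDataVW kitOf wT sc) Ak (y - (TV.toCertDataVW kitOf wT sc).x j ((TV.toCertDataVW kitOf wT sc).S j - 1))) := by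
  set s := (TV.base.stage j).S - 1 with hs
  have hSs : (TV.toCertDataVW kitOf wT sc).S j - 1 = s := rfl
  rw [hSs] at hu hA hy hr ⊢
  apply inBox_loR_of_memVec
  have hF := TV.base.readoutStep_R6 (TV.roIn kitOf wT A j) hk.coef (hk.box j) (hk.mt j) (size_hullBox 2 j s) hu.1 hu.2
    (fun i k h1 h2 => mem_ωinvB j i k h1 h2) (inStep_window hA) (Hl := Hl) (by rw [hH]; exact memVec_of_inBox_hull hy)
    (r := r) (fun c hc => by
      have hkc := TV.base.InW_wk hc
      have h1 := hr (TV.base.wi c) (TV.base.wk c) hkc.1 hkc.2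
      dsimp only at h1
      rw [bx_J, TV.base.vecF_apply, if_pos hkc, TV.base.idx_wi_wk hc] at h1
      exact h1)
  rw [hY]
  intro c hc
  have e : TV.base.wv ((TV.toCertDataVW kitOf wT sc).TP j s u + r +
      kapp (TV.toCertDataVW kitOf wT sc) Ak (y - (TV.toCertDataVW kitOf wT sc).x j s)) c =
      (∑ n ∈ Finset.range (TV.base.pdeg + 1), taylorJet (TV.base.toCertData QS2.toRealHom).Qb (TV.base.vecF (vre (TV.xD j s))) n
          (TV.base.wi c) (TV.base.wk c) * u ^ n) + TV.base.wv r c +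
        ∑ c' ∈ Finset.range TV.base.n, Ak (TV.base.wi c) (TV.base.wk c) (TV.base.wi c') (TV.base.wk c') *
          (TV.base.wv y c' - vre (TV.xD j s) c') := by
    rw [TV.base.wv_add, TV.base.wv_add, wv_kapp Ak _ hc]
    have e1 : TV.base.wv ((TV.toCertDataVW kitOf wT sc).TP j s u) c =
        ∑ n ∈ Finset.range (TV.base.pdeg + 1), taylorJet (TV.base.toCertData QS2.toRealHom).Qb (TV.base.vecF (vre (TV.xD j s))) n
          (TV.base.wi c) (TV.base.wk c) * u ^ n := rfl
    have e2 : ∀ c' ∈ Finset.range TV.base.n, TV.base.wv (y - (TV.toCertDataVW kitOf wT sc).x j s) c' = TV.base.wv y c' - vre (TV.xD j s) c' := by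
      intro c' hc'
      rw [← TV.base.wv_vecF (vre (TV.xD j s)) (Finset.mem_range.1 hc')]
      rfl
    rw [e1]
    congr 1
    exact Finset.sum_congr rfl fun c' hc' => by rw [e2 c' hc']
  rw [e]
  exact hF c hc

/-- **(R6)** of `ReadoutsV` at stage `j`. [folklore] -/
theorem readout_R6 (hk : KitOK TV kitOf) {G : ℕ → ℕ → ℕ → ℝ} {ΛT : ℕ → ℝ} {j : ℕ} :
    ∀ l : Fin 2, ∀ u ∈ Icc 0 ((TV.toCertDataVW kitOf wT sc).h j ((TV.toCertDataVW kitOf wT sc).S j - 1)), ∀ Ak : Ker,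
      InStepKer (TV.toCertDataVW kitOf wT sc) (TV.toBoxesW kitOf wT) j ((TV.toCertDataVW kitOf wT sc).S j - 1) u Ak →
      ∀ y, InBox (TV.toCertDataVW kitOf wT sc) ((TV.toBoxesW kitOf wT).hlo (hullLevel l) j ((TV.toCertDataVW kitOf wT sc).S j - 1))
          ((TV.toBoxesW kitOf wT).hhi (hullLevel l) j ((TV.toCertDataVW kitOf wT sc).S j - 1)) y →
      ∀ r : Fin 4 → ℤ → ℝ, AbsLeW (TV.toCertDataVW kitOf wT sc) r
          (fun i k => (TV.toBoxesW kitOf wT).J j ((TV.toCertDataVW kitOf wT sc).S j - 1) i k * u ^ ((TV.toCertDataVW kitOf wT sc).pdeg + 1)) →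
        InBox (TV.toCertDataVW kitOf wT sc) ((TV.toReadoutData kitOf wT A G ΛT).ylo l j) ((TV.toReadoutData kitOf wT A G ΛT).yhi l j)
          ((TV.toCertDataVW kitOf wT sc).TP j ((TV.toCertDataVW kitOf wT sc).S j - 1) u + r +
            kapp (TV.toCertDataVW kitOf wT sc) Ak (y - (TV.toCertDataVW kitOf wT sc).x j ((TV.toCertDataVW kitOf wT sc).S j - 1))) := by
  intro l u hu Ak hA y hy r hr
  rcases l with ⟨_ | _ | l2, hl⟩
  · exact readout_R6_gen hk (l := 0) rfl rfl hu hA hy hr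
  · exact readout_R6_gen hk (l := 1) rfl rfl hu hA hy hr
  · omega

/-! ### (R10) the derivative kernel -/

/-- **(R10)** of `ReadoutsV` at stage `j`. [folklore] -/
theorem readout_R10 (hk : KitOK TV kitOf) {G : ℕ → ℕ → ℕ → ℝ} {ΛT : ℕ → ℝ} {j : ℕ} :
    ∀ u ∈ Icc 0 ((TV.toCertDataVW kitOf wT sc).h j ((TV.toCertDataVW kitOf wT sc).S j - 1)), ∀ Ak : Ker,
      InStepKer (TV.toCertDataVW kitOf wT sc) (TV.toBoxesW kitOf wT) j ((TV.toCertDataVW kitOf wT sc).S j - 1) u Ak →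
      ∀ W : Ker, KerMem (TV.toCertDataVW kitOf wT sc) W ((TV.toRadiiW kitOf wT).Zlo j ((TV.toCertDataVW kitOf wT sc).S j - 1))
          ((TV.toRadiiW kitOf wT).Zhi j ((TV.toCertDataVW kitOf wT sc).S j - 1)) →
        KerMem (TV.toCertDataVW kitOf wT sc)
          (kerOf fun v => kapp (TV.toCertDataVW kitOf wT sc) Ak ((TV.toRadiiW kitOf wT).Vc j ((TV.toCertDataVW kitOf wT sc).S j - 1) v +
            (TV.toCertDataVW kitOf wT sc).Cm j ((TV.toCertDataVW kitOf wT sc).S j - 1) (kapp (TV.toCertDataVW kitOf wT sc) W v)))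
          ((TV.toReadoutData kitOf wT A G ΛT).Vlo j) ((TV.toReadoutData kitOf wT A G ΛT).Vhi j) := by
  intro u hu Ak hA W hW
  set s := (TV.base.stage j).S - 1 with hs
  have hSs : (TV.toCertDataVW kitOf wT sc).S j - 1 = s := rfl
  rw [hSs] at hu hA hW ⊢
  have hwm : MemMat TV.base.n (TV.base.matOfKer W) (TV.nodeVW kitOf wT j s).Z := TV.base.memMat_matOfKer cd_Kb cd_Ka hW
  have hM := TV.base.readoutStep_R10 (TV.roIn kitOf wT A j) hk.coef (hk.box j) (size_hullBox 2 j s) hu.1 hu.2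
    (fun i k h1 h2 => mem_ωinvB j i k h1 h2) (inStep_window hA) hwm
  intro i' k' hk1' hk2' i k hk1 hk2
  have hk' : -TV.base.Kb ≤ k' ∧ k' ≤ TV.base.Ka := ⟨hk1', hk2'⟩
  have hkk : -TV.base.Kb ≤ k ∧ k ≤ TV.base.Ka := ⟨hk1, hk2⟩
  have hr := TV.base.idx_lt_n i' hk'
  have hc := TV.base.idx_lt_n i hkk
  have hm := hM _ hr _ hc
  -- the kernel entry is the product entry
  have e : kerOf (fun v => kapp (TV.toCertDataVW kitOf wT sc) Ak ((TV.toRadiiW kitOf wT).Vc j s v +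
        (TV.toCertDataVW kitOf wT sc).Cm j s (kapp (TV.toCertDataVW kitOf wT sc) W v))) i' k' i k =
      ∑ t ∈ Finset.range TV.base.n, Ak (TV.base.wi (TV.base.idx i' k')) (TV.base.wk (TV.base.idx i' k')) (TV.base.wi t) (TV.base.wk t) *
        (dre (TV.nodeVW kitOf wT j s).Vc t (TV.base.idx i k) +
          ∑ t' ∈ Finset.range TV.base.n, dre (TV.nodeVW kitOf wT j s).B t t' * TV.base.matOfKer W t' (TV.base.idx i k)) := by
    unfold kerOf
    beta_reduce
    rw [kapp_window Ak _ i' hk', TV.base.wi_idx i' hk', TV.base.wk_idx i' hk']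
    refine Finset.sum_congr rfl fun t ht => ?_
    have ht' := Finset.mem_range.1 ht
    congr 1
    rw [rd_Vc, cd_Cm, TV.base.wv_add, TV.base.wv_linF _ _ ht', TV.base.wv_linF _ _ ht']
    congr 1
    · rw [Finset.sum_congr rfl (fun c hc' => by rw [wv_basisSt i hkk (Finset.mem_range.1 hc')])]
      simp only [mul_ite, mul_one, mul_zero]
      rw [Finset.sum_ite_eq' (Finset.range TV.base.n) (TV.base.idx i k), if_pos (Finset.mem_range.2 hc)]
    · refine Finset.sum_congr rfl fun t' ht'' => ?_
      congr 1
      rw [wv_kapp W _ (Finset.mem_range.1 ht'')]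
      unfold CertTables.matOfKer
      rw [Finset.sum_congr rfl (fun c hc' => by rw [wv_basisSt i hkk (Finset.mem_range.1 hc')])]
      simp only [mul_ite, mul_one, mul_zero]
      rw [Finset.sum_ite_eq' (Finset.range TV.base.n) (TV.base.idx i k), if_pos (Finset.mem_range.2 hc),
        TV.base.wi_idx i hkk, TV.base.wk_idx i hkk]
  rw [e, ro_Vlo, ro_Vhi]
  exact hm

/-! ### Faces, partners, lists -/

/-- [folklore] -/
theorem mem_faceB (J' nF' : ℕ) : ∀ l < nF', ∀ a < TV.base.n,
    IntervalD.mem (QS2.toRealHom (vget ((TV.base.stage J').ell.getD l []) a)) (IntervalD.aget (IntervalD.lget (TV.faceB J' nF') l) a) := by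
  intro l hl a ha
  unfold faceB; rw [IntervalD.lget_ofFn _ hl]; exact mem_covB _ a ha

/-- [folklore] -/
theorem mem_listB (v : List QS2) (nF' : ℕ) : ∀ l < nF', IntervalD.mem (QS2.toRealHom (vget v l)) (IntervalD.aget (TV.listB v nF') l) := by
  intro l hl
  unfold listB; rw [IntervalD.aget_ofFn _ hl]; exact IntervalD.mem_ofQS2 _ _

/-- The PARTNER rows (real). [folklore] -/
noncomputable def gPart (TV : CertTablesV) (j : ℕ) (l c : ℕ) : ℝ :=
  if l + TV.base.n < (TV.base.stage j).ell.length then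
    QS2.toRealHom (vget ((TV.base.stage j).ell.getD (l + TV.base.n) []) c) * (dget (TV.stageV j).D c).toReal else 0

/-- The PARTNER radii (real). [folklore] -/
noncomputable def rPart (TV : CertTablesV) (j : ℕ) (l : ℕ) : ℝ :=
  if l + TV.base.n < (TV.base.stage j).ell.length then
    QS2.toRealHom (vget (TV.base.stage j).rad (l + TV.base.n)) +
      (IntervalD.mag (IntervalD.subR TV.prec (IntervalD.dotR TV.prec TV.base.n (TV.covB ((TV.base.stage j).ell.getD (l + TV.base.n) []))
        (IntervalD.pointBoxA TV.base.n (TV.stageV j).yb)) (IntervalD.ofQS2 TV.prec (vget (TV.base.stage j).ctr (l + TV.base.n))))).toReal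
  else 0

/-- [folklore] -/
theorem mem_partnerG (j nF' : ℕ) : ∀ l < nF', ∀ c < TV.base.n,
    IntervalD.mem (TV.gPart j l c) (IntervalD.aget (IntervalD.lget (TV.partnerG j nF') l) c) := by
  intro l hl c hc
  unfold partnerG gPart
  rw [IntervalD.lget_ofFn _ hl, IntervalD.aget_ofFn _ hc]
  by_cases hp : l + TV.base.n < (TV.base.stage j).ell.length
  · simp only [hp, if_true]
    exact IntervalD.mem_mulR _ (IntervalD.mem_ofQS2 _ _) (IntervalD.mem_ofDyad _)
  · simp only [hp, if_false]
    simpa using IntervalD.mem_ofInt 0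

/-- [folklore] -/
theorem mem_partnerR (j nF' : ℕ) : ∀ l < nF', IntervalD.mem (TV.rPart j l) (IntervalD.aget (TV.partnerR j nF') l) := by
  intro l hl
  unfold partnerR rPart
  rw [IntervalD.aget_ofFn _ hl]
  by_cases hp : l + TV.base.n < (TV.base.stage j).ell.length
  · simp only [hp, if_true]
    exact IntervalD.mem_addR _ (IntervalD.mem_ofQS2 _ _) (IntervalD.mem_ofDyad _)
  · simp only [hp, if_false]
    simpa using IntervalD.mem_ofInt 0

/-- **The partner-face constraint** from `InPoly`: for `q = x j 0 + Dsc ζ` on the window, every partner face `l` obeys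
`|Σ_c g_{l,c} · wv ζ c| ≤ rP_l`. [folklore] -/
theorem partner_face {j : ℕ} {q ζ : Fin 4 → ℤ → ℝ} (hq : InPoly (TV.toCertDataVW kitOf wT sc) j q)
    (hwin : ∀ i k, -(TV.toCertDataVW kitOf wT sc).Kb ≤ k → k ≤ (TV.toCertDataVW kitOf wT sc).Ka →
      q i k = ((TV.toCertDataVW kitOf wT sc).x j 0 + (TV.toRadiiW kitOf wT).Dsc j ζ) i k) (l : ℕ) :
    |∑ c ∈ Finset.range TV.base.n, TV.gPart j l c * TV.base.wv ζ c| ≤ TV.rPart j l := by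
  unfold gPart rPart
  by_cases hp : l + TV.base.n < (TV.base.stage j).ell.length
  · simp only [hp, if_true]
    set L := l + TV.base.n with hL
    set w := (TV.base.stage j).ell.getD L [] with hw
    have hP := hq L
    rw [cd_ell, cd_ctr, cd_rad] at hP
    -- window values of q
    have hqc : ∀ c < TV.base.n, TV.base.wv q c = vre (TV.stageV j).yb c + (dget (TV.stageV j).D c).toReal * TV.base.wv ζ c := by
      intro c hc
      have hkc := TV.base.InW_wk hc
      have h1 := hwin (TV.base.wi c) (TV.base.wk c) hkc.1 hkc.2
      unfold CertTables.wv
      rw [h1, cd_x, rd_Dsc, Pi.add_apply, Pi.add_apply]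
      have e1 : TV.xR j 0 (TV.base.wi c) (TV.base.wk c) = vre (TV.stageV j).yb c := by
        have := TV.base.wv_vecF (vre (TV.xD j 0)) hc
        unfold CertTables.wv at this
        exact this
      have e2 : TV.base.linF (dre (diagD TV.base.n (TV.stageV j).D)) ζ (TV.base.wi c) (TV.base.wk c) =
          (dget (TV.stageV j).D c).toReal * TV.base.wv ζ c := by
        have := TV.base.wv_linF (dre (diagD TV.base.n (TV.stageV j).D)) ζ hc
        unfold CertTables.wv at this ⊢
        rw [this]
        have : ∑ c' ∈ Finset.range TV.base.n, dre (diagD TV.base.n (TV.stageV j).D) c c' * ζ (TV.base.wi c') (TV.base.wk c')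
            = ∑ c' ∈ Finset.range TV.base.n, (if c' = c then (dget (TV.stageV j).D c).toReal * ζ (TV.base.wi c') (TV.base.wk c') else 0) := by
          refine Finset.sum_congr rfl fun c' hc' => ?_
          rw [dre_diagD _ hc (Finset.mem_range.1 hc')]
          by_cases h : c = c'
          · subst h; simp [vre]
          · rw [if_neg h, if_neg (Ne.symm h), zero_mul]
        rw [this, Finset.sum_ite_eq' (Finset.range TV.base.n) c, if_pos (Finset.mem_range.2 hc)]
      rw [e1, e2]
      rfl
    -- the face value at q splits
    have hsplit : TV.base.covR QS2.toRealHom w q =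
        TV.base.covR QS2.toRealHom w (TV.xR j 0) + ∑ c ∈ Finset.range TV.base.n,
          QS2.toRealHom (vget w c) * (dget (TV.stageV j).D c).toReal * TV.base.wv ζ c := by
      rw [TV.base.covR_apply _ w q, TV.base.covR_apply _ w (TV.xR j 0), ← Finset.sum_add_distrib]
      refine Finset.sum_congr rfl fun c hc => ?_
      rw [hqc c (Finset.mem_range.1 hc), show TV.xR j 0 = TV.base.vecF (vre (TV.xD j 0)) from rfl,
        TV.base.wv_vecF _ (Finset.mem_range.1 hc)]
      show _ = QS2.toRealHom (vget w c) * vre (TV.stageV j).yb c + _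
      ring
    have hyb : IntervalD.mem (TV.base.covR QS2.toRealHom w (TV.xR j 0) - QS2.toRealHom (vget (TV.base.stage j).ctr L))
        (IntervalD.subR TV.prec (IntervalD.dotR TV.prec TV.base.n (TV.covB w) (IntervalD.pointBoxA TV.base.n (TV.stageV j).yb))
          (IntervalD.ofQS2 TV.prec (vget (TV.base.stage j).ctr L))) := by
      refine IntervalD.mem_subR _ (TV.base.mem_covR_dotR (mem_covB w) TV.prec (fun c hc => ?_)) (IntervalD.mem_ofQS2 _ _)
      rw [show TV.xR j 0 = TV.base.vecF (vre (TV.xD j 0)) from rfl, TV.base.wv_vecF _ hc]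
      exact IntervalD.mem_pointBoxA _ hc
    have hmag := IntervalD.abs_le_mag hyb
    have e : ∑ c ∈ Finset.range TV.base.n, QS2.toRealHom (vget w c) * (dget (TV.stageV j).D c).toReal * TV.base.wv ζ c =
        (TV.base.covR QS2.toRealHom w q - QS2.toRealHom (vget (TV.base.stage j).ctr L)) -
          (TV.base.covR QS2.toRealHom w (TV.xR j 0) - QS2.toRealHom (vget (TV.base.stage j).ctr L)) := by
      rw [hsplit]; ring
    rw [e]
    refine le_trans (abs_sub _ _) ?_
    exact add_le_add hP hmag
  · simp only [hp, if_false]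
    simp

/-- The face count dominates the lengths of the lists read. [folklore] -/
theorem lengths_le_nF (j : ℕ) :
    (TV.base.stage (TV.base.stage j).nx).ell.length ≤ TV.nF j ∧ (TV.base.stage j).β.length ≤ TV.nF j ∧
    (TV.base.stage (TV.base.stage j).nx).ctr.length ≤ TV.nF j ∧ (TV.base.stage (TV.base.stage j).nx).rad.length ≤ TV.nF j ∧
    (TV.base.stage (TV.base.stage j).nx).s.length ≤ TV.nF j := by
  unfold nF
  refine ⟨?_, ?_, ?_, ?_, ?_⟩ <;> simp only [le_max_iff, le_refl, true_or, or_true]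

/-! ### (R9) base landing -/

/-- **(R9)** of `ReadoutsV` at stage `j`. [folklore] -/
theorem readout_R9 (hA : TV.base.checkReadoutAux A = true) {G : ℕ → ℕ → ℕ → ℝ} {ΛT : ℕ → ℝ} {j : ℕ} (hok : (TV.roOut kitOf wT A j).ok = true) :
    ∀ y, InBox (TV.toCertDataVW kitOf wT sc) ((TV.toReadoutData kitOf wT A G ΛT).ylo 0 j) ((TV.toReadoutData kitOf wT A G ΛT).yhi 0 j) y →
      (TV.toCertDataVW kitOf wT sc).σf j y = (TV.toCertDataVW kitOf wT sc).lev j → ∀ v, TailOK (TV.toCertDataVW kitOf wT sc) v → ∀ l,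
      |(TV.toCertDataVW kitOf wT sc).ℓ ((TV.toCertDataVW kitOf wT sc).nx j) l ((TV.toCertDataVW kitOf wT sc).land j y v) -
          (TV.toCertDataVW kitOf wT sc).ctr ((TV.toCertDataVW kitOf wT sc).nx j) l| + (TV.toCertDataVW kitOf wT sc).β j l ≤
        (TV.toCertDataVW kitOf wT sc).rad ((TV.toCertDataVW kitOf wT sc).nx j) l - (TV.toCertDataVW kitOf wT sc).s ((TV.toCertDataVW kitOf wT sc).nx j) l := by
  intro y hy _ v hv l
  rw [ro_ylo0, ro_yhi0] at hy
  rw [cd_nx, cd_ell, cd_land, cd_ctr, cd_beta, cd_rad, cd_sl]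
  by_cases hl : l < TV.nF j
  · exact TV.base.readoutStep_R9 (TV.roIn kitOf wT A j) hok (mem_faceB _ _) (mem_listB _ _) (mem_listB _ _) (mem_listB _ _) (mem_listB _ _)
      (IntervalD.mem_ofQS2 _ _) (tail_le (kitOf := kitOf) (wT := wT) (sc := sc) hA hv) (memVec_of_inBox_loR hy) hl
  · rw [not_lt] at hl
    obtain ⟨h1, h2, h3, h4, h5⟩ := lengths_le_nF (TV := TV) j
    rw [List.getD_eq_default _ _ (le_trans h1 hl), TV.base.covR_nil, vget_of_le _ (le_trans h2 hl), vget_of_le _ (le_trans h3 hl),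
      vget_of_le _ (le_trans h4 hl), vget_of_le _ (le_trans h5 hl)]
    simp

/-! ### (R11) landing derivative -/

/-- **(R11)** of `ReadoutsV` at stage `j`, given the ENTRY box of the polytope parametrisation. [folklore] -/
theorem readout_R11 (hk : KitOK TV kitOf) (hA : TV.base.checkReadoutAux A = true) {G : ℕ → ℕ → ℕ → ℝ} {ΛT : ℕ → ℝ} {j : ℕ}
    (hok : (TV.roOut kitOf wT A j).ok = true)
    (hentry : ∀ q ζ : Fin 4 → ℤ → ℝ, InPoly (TV.toCertDataVW kitOf wT sc) j q →
      (∀ i k, -(TV.toCertDataVW kitOf wT sc).Kb ≤ k → k ≤ (TV.toCertDataVW kitOf wT sc).Ka →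
        q i k = ((TV.toCertDataVW kitOf wT sc).x j 0 + (TV.toRadiiW kitOf wT).Dsc j ζ) i k) →
      ∀ c < TV.base.n, |TV.base.wv ζ c| ≤ (dget (TV.stageV j).rB c).toReal) :
    ∀ y, InBox (TV.toCertDataVW kitOf wT sc) ((TV.toReadoutData kitOf wT A G ΛT).ylo 1 j) ((TV.toReadoutData kitOf wT A G ΛT).yhi 1 j) y →
      (TV.toCertDataVW kitOf wT sc).σf j y = (TV.toCertDataVW kitOf wT sc).lev j →
      ∀ V : Ker, KerMem (TV.toCertDataVW kitOf wT sc) V ((TV.toReadoutData kitOf wT A G ΛT).Vlo j) ((TV.toReadoutData kitOf wT A G ΛT).Vhi j) →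
      ∀ q ζ : Fin 4 → ℤ → ℝ, InPoly (TV.toCertDataVW kitOf wT sc) j q →
        (∀ i k, -(TV.toCertDataVW kitOf wT sc).Kb ≤ k → k ≤ (TV.toCertDataVW kitOf wT sc).Ka →
          q i k = ((TV.toCertDataVW kitOf wT sc).x j 0 + (TV.toRadiiW kitOf wT).Dsc j ζ) i k) →
      ∀ v, TailOK (TV.toCertDataVW kitOf wT sc) v → ∀ l,
        |(TV.toCertDataVW kitOf wT sc).ℓ ((TV.toCertDataVW kitOf wT sc).nx j) l
          ((TV.toCertDataVW kitOf wT sc).landD j y v (secCorr (TV.toCertDataVW kitOf wT sc) j y (kapp (TV.toCertDataVW kitOf wT sc) V ζ)))|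
          ≤ (TV.toCertDataVW kitOf wT sc).β j l := by
  intro y hy _ V hV q ζ hq hwin v hv l
  rw [ro_ylo1, ro_yhi1] at hy
  rw [ro_Vlo, ro_Vhi] at hV
  rw [cd_nx, cd_ell, cd_landD, cd_secCorr, cd_beta]
  by_cases hl : l < TV.nF j
  · rw [TV.base.covR_apply]
    exact TV.base.readoutStep_R11 (TV.roIn kitOf wT A j) hk.coef (hk.box j) (hk.mt j) hok (mem_faceB _ _) (mem_partnerG j _)
      (mem_partnerR j _) (mem_listB _ _) (IntervalD.mem_ofQS2 _ _) (tail_le (kitOf := kitOf) (wT := wT) (sc := sc) hA hv)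
      (memVec_of_inBox_loR hy) (mem_covB _) (TV.base.memMat_matOfKer cd_Kb cd_Ka hV) (hentry q ζ hq hwin)
      (fun l' _ => partner_face hq hwin l') (fun b hb => wv_kapp V ζ hb) hl
  · rw [not_lt] at hl
    obtain ⟨h1, h2, _, _, _⟩ := lengths_le_nF (TV := TV) j
    rw [List.getD_eq_default _ _ (le_trans h1 hl), TV.base.covR_nil, vget_of_le _ (le_trans h2 hl)]
    simp

/-! ### Assembly -/

/-- **The read-outs of the interpreted v3 certificate from the read-out checks**: given the kit hypotheses, the Boolean
`checkReadouts = true`, the composer's clauses (R0)–(R3) and the ENTRY box of the polytope parametrisation, the records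
satisfy `ReadoutsV`. [folklore] -/
theorem readoutsV_of_checks (hk : KitOK TV kitOf) (hchk : TV.checkReadouts kitOf wT A = true) {G : ℕ → ℕ → ℕ → ℝ} {ΛT : ℕ → ℝ}
    (hR0 : ∀ j, j ≤ TV.base.N₀ →
      (TV.toCertDataVW kitOf wT sc).Tn j ((TV.toCertDataVW kitOf wT sc).S j) ≤ (TV.toCertDataVW kitOf wT sc).τs ∧
      InPoly (TV.toCertDataVW kitOf wT sc) j ((TV.toCertDataVW kitOf wT sc).x j 0) ∧ 0 < (TV.toCertDataVW kitOf wT sc).γ j ∧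
      0 ≤ (TV.toReadoutData kitOf wT A G ΛT).ΛT j ∧
      (∀ y : Fin 4 → ℤ → ℝ, (TV.toCertDataVW kitOf wT sc).σf j y = (TV.toCertDataVW kitOf wT sc).σf j (trunc (TV.toCertDataVW kitOf wT sc) y)))
    (hR1 : ∀ j, j ≤ TV.base.N₀ → ∀ s', s' ≤ (TV.toCertDataVW kitOf wT sc).S j → ∀ y d : Fin 4 → ℤ → ℝ,
      InBox (TV.toCertDataVW kitOf wT sc) ((TV.toBoxesW kitOf wT).hlo 1 j s') ((TV.toBoxesW kitOf wT).hhi 1 j s') y →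
      (TV.toCertDataVW kitOf wT sc).InBall j d ((TV.toReadoutData kitOf wT A G ΛT).ΛT j * (TV.toCertDataVW kitOf wT sc).κ j) →
      InBox (TV.toCertDataVW kitOf wT sc) ((TV.toBoxesW kitOf wT).hlo 2 j s') ((TV.toBoxesW kitOf wT).hhi 2 j s') (y + d))
    (hR2 : ∀ j, j ≤ TV.base.N₀ → ∀ s₀ s₁, s₀ ≤ s₁ → s₁ ≤ (TV.toCertDataVW kitOf wT sc).S j → ∀ Ac : ℕ → Ker,
      (∀ s', s₀ ≤ s' → s' < s₁ → KerMem (TV.toCertDataVW kitOf wT sc) (Ac s') ((TV.toBoxesW kitOf wT).Mlo j s') ((TV.toBoxesW kitOf wT).Mhi j s')) →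
      ∀ (v : Fin 4 → ℤ → ℝ) (r : ℝ), 0 ≤ r → (TV.toCertDataVW kitOf wT sc).InBall j v r →
        (TV.toCertDataVW kitOf wT sc).InBall j (kiter (TV.toCertDataVW kitOf wT sc) Ac s₀ (s₁ - s₀) v) ((TV.toReadoutData kitOf wT A G ΛT).G j s₀ s₁ * r))
    (hR3a : ∀ j, j ≤ TV.base.N₀ → ∀ a b, a < (TV.toCertDataVW kitOf wT sc).S j → a + 1 ≤ b → b ≤ (TV.toCertDataVW kitOf wT sc).S j →
      (TV.toCertDataVW kitOf wT sc).L1 j a * (TV.toReadoutData kitOf wT A G ΛT).G j (a + 1) b ≤ (TV.toReadoutData kitOf wT A G ΛT).ΛT j ∧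
      (b < (TV.toCertDataVW kitOf wT sc).S j →
        (TV.toCertDataVW kitOf wT sc).L1 j a * (TV.toReadoutData kitOf wT A G ΛT).G j (a + 1) b * (TV.toCertDataVW kitOf wT sc).L1 j b ≤
          (TV.toCertDataVW kitOf wT sc).Λ j))
    (hR3b : ∀ j, j ≤ TV.base.N₀ → ∀ a, a < (TV.toCertDataVW kitOf wT sc).S j → (TV.toCertDataVW kitOf wT sc).L1 j a ≤ (TV.toCertDataVW kitOf wT sc).Λ j)
    (hentry : ∀ j, j ≤ TV.base.N₀ → ∀ q ζ : Fin 4 → ℤ → ℝ, InPoly (TV.toCertDataVW kitOf wT sc) j q →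
      (∀ i k, -(TV.toCertDataVW kitOf wT sc).Kb ≤ k → k ≤ (TV.toCertDataVW kitOf wT sc).Ka →
        q i k = ((TV.toCertDataVW kitOf wT sc).x j 0 + (TV.toRadiiW kitOf wT).Dsc j ζ) i k) →
      ∀ c < TV.base.n, |TV.base.wv ζ c| ≤ (dget (TV.stageV j).rB c).toReal) :
    ReadoutsV (TV.toCertDataVW kitOf wT sc) (TV.toBoxesW kitOf wT) (TV.toRadiiW kitOf wT) (TV.toReadoutData kitOf wT A G ΛT) := by
  intro j hj
  have hjN : j ≤ TV.base.N₀ := hj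
  unfold checkReadouts at hchk
  simp only [Bool.and_eq_true] at hchk
  obtain ⟨hAux, hall⟩ := hchk
  have hst := (allN_eq_true.1 hall) j (Nat.lt_succ_of_le hjN)
  unfold checkReadoutStage at hst
  simp only [Bool.and_eq_true] at hst
  obtain ⟨h4, hok⟩ := hst
  obtain ⟨h0a, h0b, h0c, h0d, h0e⟩ := hR0 j hjN
  exact ⟨h0a, h0b, h0c, h0d, h0e, hR1 j hjN, hR2 j hjN, hR3a j hjN, hR3b j hjN, readout_R4 h4, (readout_R5 hok).1, (readout_R5 hok).2,
    readout_R6 hk, readout_R7 hk hok, readout_R8 hAux hok, readout_R9 hAux hok, readout_R10 hk, readout_R11 hk hAux hok (hentry j hjN)⟩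

end CertTablesV

end Summit.NavierStokesRegularity.NavierStokesRegularity.Theorems.TaylorModelCert
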